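import Mathlib
import HarnessLib
import Summits.HubbardSuperconductivity.HubbardSuperconductivity.Theorems.KLProgrammeKLRegimeCountertermContinuation
import Summits.HubbardSuperconductivity.HubbardSuperconductivity.Theorems.KLProgrammeKLRegimeCountertermBlockE

/-!
# Route `KLProgramme` — crux K3: the COUNTERTERM child's WHOLESALE CONTINUATION AT ONE VOLUME, GENERIC IN THE ENGINE SLOT
# — the `E`-generic port of k3c3-p2's `…CountertermContinuation` §2–§4 (seat hubbard-kl-k3c5-p1 g3, gen-4 port; mathematics: k3c3-p2,
# inputs k3c3-p1 / k3c3-p3 / p1b / p2)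

Gen 3's counterterm child `KLRegimeCountertermV11 = CountertermP2 klPredsV11 klWindowC` (stmt-HubbardSuperconductivity-19825) was CLOSED by k3c3-p2's
one-volume construction (one Picard step per scale; self-map by (E3a-MS), contraction by (E3c), renormalisation by reading) composed with this
lineage's volume transfer.  Those proofs never look inside the ENGINE slot: it is read only to assemble the comparison-frame history
`split ∧ renorm ∧ engine` that (E3c-G) asks of the comparison frame.  Gen 4 (Δ21) changes only the engine slot.  This module is the VERBATIM port
of `…CountertermContinuation` §2–§4 to the `E`-generic block of `…CountertermBlockE` (`CtHypMsE E`, over `…SplitTwoLegStepE`'s `histE E` /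
`TwoLegStepE E`), in the sub-namespace `CtE` with the same short names: `CtE.ctBlockAt_of_ctHypMsE`, `CtE.abs_eval_piece_le_of_block`,
`CtE.ct_frameOK_counterIter`, **`CtE.ct_step`** (one Picard step), `CtE.ct_levelUp`, **`CtE.ct_exists_post`** (the induction over the levels),
**`CtE.ct_oneVolume_of_reading`** (an admissible frame at HALF tolerance at every scale and angle, at this volume, given the reading); the numeric
heart `ct_budget` is engine-free and reused by name.  Part 2 (`…CountertermOneVolumeMsE`): the reading from the block and
`CtE.ctOneVolumeMsE_holds (E) : ∀ G P Q, WF → CtOneVolumeMsE E G P Q`, hence `CountertermP2 (klPredsE E) klWindowC` for EVERY engine slot.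
Proofs only; nothing is asserted about the Hubbard model beyond the hypothesis block.
-/

noncomputable section

namespace Summit.HubbardSuperconductivity.HubbardSuperconductivity.Theorems.KLRegimeSplit.CtE

set_option linter.dupNamespace false -- summit = problem name (single-conjunct summit), D-0017

open Real Finset
open Literature.MathematicalPhysics.QuantumLattice Literature.Probability.LatticeModels
open Summit.HubbardSuperconductivity.HubbardSuperconductivity.Theorems.KLProgrammeLegKernels
open Summit.HubbardSuperconductivity.HubbardSuperconductivity.Theorems.KLRegimeSplit

/-! ## §2 The block at one volume (engine slot `E`) -/

section Model

variable {L M : ℕ} [NeZero L] [NeZero M] {E : EngSlot} {G : GeoConsts} {P : SplitConsts} {Q : EngConsts} {β U μ : ℝ}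

/-- The block for the engine slot `E` (package `ctRenMs G`) specialised to one volume `(L, M)` beyond the thresholds. -/
theorem ctBlockAt_of_ctHypMsE {Lh : ℕ} {Mh : ℕ → ℕ} (hyp : CtHypMsE E G P Q β U μ Lh Mh) (hL : Lh ≤ L) (hM : Mh L ≤ M) :
    ∀ K : TrigPolyC4v, FrameOK (ctRenMs G) U (nScales β) μ K → ∀ n : ℕ, n ≤ nScales β →
      (∀ j < n, RenormalisedAtF L M β U μ K (ctRenMs G) j) →
        E L M G P Q β U μ K n ∧ TwoLegStepE L M E G P Q (ctRenMs G) β U μ K n ∧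
          BetaSplitAtS2 L M G P Q β U μ K n :=
  fun K hK n hn hren => hyp K hK L M hL hM n hn hren

/-- From the block: the scale-`i` piece of a frame renormalised below `i` is bounded by `twoLegBar 0 i` everywhere ((E3a) tier 1, `j = 0`). -/
theorem abs_eval_piece_le_of_block {R : RenConsts}
    (blk : ∀ K : TrigPolyC4v, FrameOK R U (nScales β) μ K → ∀ n : ℕ, n ≤ nScales β →
      (∀ j < n, RenormalisedAtF L M β U μ K R j) →
        E L M G P Q β U μ K n ∧ TwoLegStepE L M E G P Q R β U μ K n ∧ BetaSplitAtS2 L M G P Q β U μ K n)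
    {K : TrigPolyC4v} (hK : FrameOK R U (nScales β) μ K) {i : ℕ} (hi : i ≤ nScales β)
    (hren : ∀ j < i, RenormalisedAtF L M β U μ K R j) (p : Fin 2 → ℝ) :
    |(klTwoLegPieceG L M β U μ K i).eval p| ≤ twoLegBar G Q U 0 i := by
  have h := ((blk K hK i hi hren).2.1.1).1.1 0 (by norm_num) (WithLp.toLp 2 p)
  rw [norm_iteratedFDeriv_zero, Real.norm_eq_abs] at h
  simpa [evalM] using h

end Model

/-! ## §3 One Picard step -/

section Step

variable {L M : ℕ} [NeZero L] [NeZero M] {E : EngSlot} {G : GeoConsts} {P : SplitConsts} {Q : EngConsts} {β U μ : ℝ}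
  {R : RenConsts} (wig : ℕ → ℝ)

/-- **Self-map at this volume**: for an admissible frame renormalised below `n ≤ N`, `Φ_n(K)` is admissible (Δ20: `frameOK_of_multiSlot'` fed
by the block's (E3a-MS) at the scales `i ≤ n`). -/
theorem ct_frameOK_counterIter (hG : G.WF) (hQ : Q.WF) (hμ : μ ∈ klWindowC) (hR : ∀ j, 0 ≤ R.Gfr j)
    (blk : ∀ K : TrigPolyC4v, FrameOK R U (nScales β) μ K → ∀ n : ℕ, n ≤ nScales β →
      (∀ j < n, RenormalisedAtF L M β U μ K R j) →
        E L M G P Q β U μ K n ∧ TwoLegStepE L M E G P Q R β U μ K n ∧ BetaSplitAtS2 L M G P Q β U μ K n)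
    (hroomA : ∀ j ≤ 4, 2 * (G.S j + Q.S' j * |U|) ≤ R.Gfr j) (hroomB : ∀ n : ℕ, ∑ i ∈ range (n + 1), msBar G Q U i ≤ 1 / 2)
    (h0 : ∑ m ∈ range (nScales β + 1), R.Gfr 0 * uPow 0 U * (4 : ℝ) ^ (((0 : ℤ) - 2) * m) ≤ 3 / 80)
    (h1 : ∑ m ∈ range (nScales β + 1), R.Gfr 1 * uPow 1 U * (4 : ℝ) ^ (((1 : ℤ) - 2) * m) ≤ 1 / 2000)
    (h2 : ∑ m ∈ range (nScales β + 1), ∑ j ∈ range 3, R.Gfr j * uPow j U * (4 : ℝ) ^ (((j : ℤ) - 2) * m) ≤ 1 / 100) {K : TrigPolyC4v} (hK : FrameOK R U (nScales β) μ K) {n : ℕ} (hn : n ≤ nScales β)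
    (hren : ∀ j < n, RenormalisedAtF L M β U μ K R j) :
    FrameOK R U (nScales β) μ (fsub (klFrameProjG L μ K) (klTwoLegPolyG L M β U μ K n)) := by
  refine frameOK_of_multiSlot (L := L) (M := M) hG hQ hR hn hμ (fun i hi => ?_) hroomA (hroomB n) h0 h1 h2
  exact (blk K hK i (hi.trans hn) fun j hj => hren j (lt_of_lt_of_le hj hi)).2.1.2.1

/-- **ONE PICARD STEP at level `n`.**  From an admissible `K` renormalised below `n` with `sup|S_n(K)| ≤ δ`, and the feasibility
`T̄_{j,n} + q·δ + wig j ≤ tol_j` (`j ≤ n`): `K′ = Φ_n(K)` is admissible, renormalised at every `j ≤ n`, and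
`sup|S_j(K′)| ≤ T̄_{j,n} + q·δ` (`q = (4/3)(SL + SL′|U|)|U|`, `T̄_{j,n} = Σ_{i∈Ico (j+1)(n+1)} twoLegBar 0 i`). -/
theorem ct_step (hG : G.WF) (hQ : Q.WF) (hμ : μ ∈ klWindowC) (hR : ∀ j, 0 ≤ R.Gfr j) (hcr : R.cr = ctCr G)
    (blk : ∀ K : TrigPolyC4v, FrameOK R U (nScales β) μ K → ∀ n : ℕ, n ≤ nScales β →
      (∀ j < n, RenormalisedAtF L M β U μ K R j) →
        E L M G P Q β U μ K n ∧ TwoLegStepE L M E G P Q R β U μ K n ∧ BetaSplitAtS2 L M G P Q β U μ K n)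
    (hread : ∀ K : TrigPolyC4v, FrameOK R U (nScales β) μ K → ∀ n : ℕ, n ≤ nScales β →
      (∀ j < n, RenormalisedAtF L M β U μ K R j) → ∀ B : ℝ,
        (∀ q : Fin 2 → ℝ, |K.eval q + ∑ i ∈ range (n + 1), (klTwoLegPieceG L M β U μ K i).eval q| ≤ B) →
          ∀ θ : ℝ, |klLocalPart L M β U μ K n θ| ≤ B + wig n)
    (hroomA : ∀ j ≤ 4, 2 * (G.S j + Q.S' j * |U|) ≤ R.Gfr j) (hroomB : ∀ n : ℕ, ∑ i ∈ range (n + 1), msBar G Q U i ≤ 1 / 2)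
    (h0 : ∑ m ∈ range (nScales β + 1), R.Gfr 0 * uPow 0 U * (4 : ℝ) ^ (((0 : ℤ) - 2) * m) ≤ 3 / 80)
    (h1 : ∑ m ∈ range (nScales β + 1), R.Gfr 1 * uPow 1 U * (4 : ℝ) ^ (((1 : ℤ) - 2) * m) ≤ 1 / 2000)
    (h2 : ∑ m ∈ range (nScales β + 1), ∑ j ∈ range 3, R.Gfr j * uPow j U * (4 : ℝ) ^ (((j : ℤ) - 2) * m) ≤ 1 / 100) {K : TrigPolyC4v} (hK : FrameOK R U (nScales β) μ K) {n : ℕ} (hn : n ≤ nScales β)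
    (hren : ∀ j < n, RenormalisedAtF L M β U μ K R j) {δ : ℝ} (hδ0 : 0 ≤ δ)
    (hδ : ∀ q : Fin 2 → ℝ, |K.eval q + ∑ i ∈ range (n + 1), (klTwoLegPieceG L M β U μ K i).eval q| ≤ δ)
    (hfeas : ∀ j ≤ n, ∑ i ∈ Ico (j + 1) (n + 1), twoLegBar G Q U 0 i + 4 / 3 * (G.SL + Q.SL * |U|) * |U| * δ + wig j ≤
      ctCr G * |U| * klScale klE0 j ^ 2 / klE0) :
    FrameOK R U (nScales β) μ (fsub (klFrameProjG L μ K) (klTwoLegPolyG L M β U μ K n)) ∧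
    (∀ j ≤ n, RenormalisedAtF L M β U μ (fsub (klFrameProjG L μ K) (klTwoLegPolyG L M β U μ K n)) R j) ∧
    (∀ j ≤ n, ∀ q : Fin 2 → ℝ,
      |(fsub (klFrameProjG L μ K) (klTwoLegPolyG L M β U μ K n)).eval q +
          ∑ i ∈ range (j + 1), (klTwoLegPieceG L M β U μ (fsub (klFrameProjG L μ K) (klTwoLegPolyG L M β U μ K n)) i).eval q| ≤
        ∑ i ∈ Ico (j + 1) (n + 1), twoLegBar G Q U 0 i + 4 / 3 * (G.SL + Q.SL * |U|) * |U| * δ) := by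
  set K' := fsub (klFrameProjG L μ K) (klTwoLegPolyG L M β U μ K n) with hK'def
  set qq : ℝ := 4 / 3 * (G.SL + Q.SL * |U|) * |U| with hqq
  have hK' : FrameOK R U (nScales β) μ K' := ct_frameOK_counterIter hG hQ hμ hR blk hroomA hroomB h0 h1 h2 hK hn hren
  -- the frame distance of the step
  have hdist : frameDist K K' ≤ δ := by
    refine ciSup_le fun p => ?_
    rw [← partialSum_eq_sub_counterIter]
    exact hδ p
  have hlip0 : ∀ i, 0 ≤ lipBar G Q U i := by
    intro i
    have hSL : 0 ≤ G.SL := hG.2.2.2.2.2.2.2.2.2.2.2.2.2.2.2.2.2.2.2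
    have hSL' : 0 ≤ Q.SL := hQ.2.2.2.2.2.2.1
    rw [ct_lipBar_eq]; positivity
  -- strong induction on the scale `j ≤ n`
  have main : ∀ j, j ≤ n →
      (∀ q : Fin 2 → ℝ, |K'.eval q + ∑ i ∈ range (j + 1), (klTwoLegPieceG L M β U μ K' i).eval q| ≤
        ∑ i ∈ Ico (j + 1) (n + 1), twoLegBar G Q U 0 i + qq * δ) ∧
      RenormalisedAtF L M β U μ K' R j := by
    intro j
    induction j using Nat.strong_induction_on with
    | _ j ih =>
      intro hj
      -- the history of `K'` below `j`
      have hrenK' : ∀ j' < j, RenormalisedAtF L M β U μ K' R j' := fun j' hj' => (ih j' hj' (le_of_lt (lt_of_lt_of_le hj' hj))).2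
      have hhist : ∀ j' < j, histE L M E G P Q R β U μ K' j' := by
        intro j' hj'
        have hb := blk K' hK' j' (le_of_lt (lt_of_lt_of_le (lt_of_lt_of_le hj' hj) hn)) fun i hi => hrenK' i (hi.trans hj')
        exact ⟨hb.2.2, hrenK' j' hj', hb.1⟩
      -- the bound on `S_j(K')`
      have hbound : ∀ q : Fin 2 → ℝ, |K'.eval q + ∑ i ∈ range (j + 1), (klTwoLegPieceG L M β U μ K' i).eval q| ≤
          ∑ i ∈ Ico (j + 1) (n + 1), twoLegBar G Q U 0 i + qq * δ := by
        intro q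
        have hsplit := Finset.sum_range_add_sum_Ico (fun i => (klTwoLegPieceG L M β U μ K i).eval q) (Nat.succ_le_succ hj)
        have hK'q : K'.eval q = -∑ i ∈ range (n + 1), (klTwoLegPieceG L M β U μ K i).eval q := eval_counterImage L M β U μ K n q
        have hident : K'.eval q + ∑ i ∈ range (j + 1), (klTwoLegPieceG L M β U μ K' i).eval q =
            ∑ i ∈ range (j + 1), ((klTwoLegPieceG L M β U μ K' i).eval q - (klTwoLegPieceG L M β U μ K i).eval q) -
              ∑ i ∈ Ico (j + 1) (n + 1), (klTwoLegPieceG L M β U μ K i).eval q := by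
          rw [hK'q, ← hsplit, sum_sub_distrib]; ring
        rw [hident]
        -- Lipschitz part
        have hlipsum : |∑ i ∈ range (j + 1), ((klTwoLegPieceG L M β U μ K' i).eval q - (klTwoLegPieceG L M β U μ K i).eval q)| ≤
            qq * δ := by
          refine (abs_sum_le_sum_abs _ _).trans ?_
          have hterm : ∀ i ∈ range (j + 1),
              |(klTwoLegPieceG L M β U μ K' i).eval q - (klTwoLegPieceG L M β U μ K i).eval q| ≤ lipBar G Q U i * δ := by
            intro i hi
            have hij : i ≤ j := Nat.lt_succ_iff.mp (mem_range.mp hi)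
            have hin : i ≤ nScales β := (hij.trans hj).trans hn
            have hlipi := ((blk K hK i hin fun j' hj' => hren j' (lt_of_lt_of_le hj' (hij.trans hj))).2.1.1).2.2.1
            have h := hlipi K' hK' (fun j' hj' => hhist j' (lt_of_lt_of_le hj' hij)) q
            rw [abs_sub_comm] at h
            exact h.trans (mul_le_mul_of_nonneg_left hdist (hlip0 i))
          refine (sum_le_sum hterm).trans ?_
          rw [← sum_mul]
          exact mul_le_mul_of_nonneg_right (ct_sum_lipBar_le hG hQ U (j + 1)) hδ0
        -- tail part
        have htailsum : |∑ i ∈ Ico (j + 1) (n + 1), (klTwoLegPieceG L M β U μ K i).eval q| ≤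
            ∑ i ∈ Ico (j + 1) (n + 1), twoLegBar G Q U 0 i := by
          refine (abs_sum_le_sum_abs _ _).trans (sum_le_sum fun i hi => ?_)
          have hin : i ≤ n := Nat.lt_succ_iff.mp (mem_Ico.mp hi).2
          exact abs_eval_piece_le_of_block blk hK (hin.trans hn) (fun j' hj' => hren j' (lt_of_lt_of_le hj' hin)) q
        calc |∑ i ∈ range (j + 1), ((klTwoLegPieceG L M β U μ K' i).eval q - (klTwoLegPieceG L M β U μ K i).eval q) -
              ∑ i ∈ Ico (j + 1) (n + 1), (klTwoLegPieceG L M β U μ K i).eval q|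
            ≤ |∑ i ∈ range (j + 1), ((klTwoLegPieceG L M β U μ K' i).eval q - (klTwoLegPieceG L M β U μ K i).eval q)| +
              |∑ i ∈ Ico (j + 1) (n + 1), (klTwoLegPieceG L M β U μ K i).eval q| := abs_sub _ _
          _ ≤ qq * δ + ∑ i ∈ Ico (j + 1) (n + 1), twoLegBar G Q U 0 i := add_le_add hlipsum htailsum
          _ = _ := by ring
      refine ⟨hbound, ?_⟩
      -- renormalisation at `j` by the reading hypothesis
      intro θ
      have h := hread K' hK' j (hj.trans hn) hrenK' _ hbound θ
      have hf := hfeas j hj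
      show |klLocalPart L M β U μ K' j θ| ≤ R.cr * |U| * klScale klE0 j ^ 2 / klE0
      rw [hcr]
      linarith
  exact ⟨hK', fun j hj => (main j hj).2, fun j hj => (main j hj).1⟩

/-- **LEVEL-UP**: a frame renormalised at every `j ≤ n` with `sup|S_n(K)| ≤ e` has `sup|S_{n+1}(K)| ≤ e + twoLegBar 0 (n+1)` (one more
piece, its size from the block) — the pre-step data at level `n + 1`. -/
theorem ct_levelUp
    (blk : ∀ K : TrigPolyC4v, FrameOK R U (nScales β) μ K → ∀ n : ℕ, n ≤ nScales β →
      (∀ j < n, RenormalisedAtF L M β U μ K R j) →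
        E L M G P Q β U μ K n ∧ TwoLegStepE L M E G P Q R β U μ K n ∧ BetaSplitAtS2 L M G P Q β U μ K n) {K : TrigPolyC4v} (hK : FrameOK R U (nScales β) μ K) {n : ℕ} (hn : n + 1 ≤ nScales β)
    (hren : ∀ j ≤ n, RenormalisedAtF L M β U μ K R j) {e : ℝ}
    (hS : ∀ q : Fin 2 → ℝ, |K.eval q + ∑ i ∈ range (n + 1), (klTwoLegPieceG L M β U μ K i).eval q| ≤ e) :
    (∀ j < n + 1, RenormalisedAtF L M β U μ K R j) ∧
    ∀ q : Fin 2 → ℝ, |K.eval q + ∑ i ∈ range (n + 1 + 1), (klTwoLegPieceG L M β U μ K i).eval q| ≤ e + twoLegBar G Q U 0 (n + 1) := by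
  have hren' : ∀ j < n + 1, RenormalisedAtF L M β U μ K R j := fun j hj => hren j (Nat.lt_succ_iff.mp hj)
  refine ⟨hren', fun q => ?_⟩
  rw [sum_range_succ, ← add_assoc]
  refine (abs_add_le _ _).trans (add_le_add (hS q) ?_)
  exact abs_eval_piece_le_of_block blk hK hn hren' q

end Step

/-! ## §4 The induction over the levels and the one-volume construction -/

section Main

variable {L M : ℕ} [NeZero L] [NeZero M] {E : EngSlot} {G : GeoConsts} {P : SplitConsts} {Q : EngConsts} {β U μ : ℝ}
  {R : RenConsts} (wig : ℕ → ℝ)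

/-- **The induction over the levels** (one Picard step per level): for every `n ≤ N` there is an admissible frame, renormalised at every
`j ≤ n`, with `sup|S_j(K)| ≤ T̄_{j,n} + q·(2·twoLegBar 0 n)` for `j ≤ n`. -/
theorem ct_exists_post (hG : G.WF) (hQ : Q.WF) (hμ : μ ∈ klWindowC) (hR : ∀ j, 0 ≤ R.Gfr j) (hcr : R.cr = ctCr G)
    (blk : ∀ K : TrigPolyC4v, FrameOK R U (nScales β) μ K → ∀ n : ℕ, n ≤ nScales β →
      (∀ j < n, RenormalisedAtF L M β U μ K R j) →
        E L M G P Q β U μ K n ∧ TwoLegStepE L M E G P Q R β U μ K n ∧ BetaSplitAtS2 L M G P Q β U μ K n)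
    (hread : ∀ K : TrigPolyC4v, FrameOK R U (nScales β) μ K → ∀ n : ℕ, n ≤ nScales β →
      (∀ j < n, RenormalisedAtF L M β U μ K R j) → ∀ B : ℝ,
        (∀ q : Fin 2 → ℝ, |K.eval q + ∑ i ∈ range (n + 1), (klTwoLegPieceG L M β U μ K i).eval q| ≤ B) →
          ∀ θ : ℝ, |klLocalPart L M β U μ K n θ| ≤ B + wig n)
    (hwig : ∀ n ≤ nScales β, wig n ≤ |U| * ((16 : ℝ) ^ n)⁻¹ / 256)
    (hS0' : Q.S' 0 * |U| ≤ 1 / 10) (hq : 4 / 3 * (G.SL + Q.SL * |U|) * |U| ≤ 1 / 1000)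
    (hroomA : ∀ j ≤ 4, 2 * (G.S j + Q.S' j * |U|) ≤ R.Gfr j) (hroomB : ∀ n : ℕ, ∑ i ∈ range (n + 1), msBar G Q U i ≤ 1 / 2)
    (h0 : ∑ m ∈ range (nScales β + 1), R.Gfr 0 * uPow 0 U * (4 : ℝ) ^ (((0 : ℤ) - 2) * m) ≤ 3 / 80)
    (h1 : ∑ m ∈ range (nScales β + 1), R.Gfr 1 * uPow 1 U * (4 : ℝ) ^ (((1 : ℤ) - 2) * m) ≤ 1 / 2000)
    (h2 : ∑ m ∈ range (nScales β + 1), ∑ j ∈ range 3, R.Gfr j * uPow j U * (4 : ℝ) ^ (((j : ℤ) - 2) * m) ≤ 1 / 100) (n : ℕ) (hn : n ≤ nScales β) :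
    ∃ K : TrigPolyC4v, FrameOK R U (nScales β) μ K ∧ (∀ j ≤ n, RenormalisedAtF L M β U μ K R j) ∧
      ∀ j ≤ n, ∀ q : Fin 2 → ℝ, |K.eval q + ∑ i ∈ range (j + 1), (klTwoLegPieceG L M β U μ K i).eval q| ≤
        ∑ i ∈ Ico (j + 1) (n + 1), twoLegBar G Q U 0 i + 4 / 3 * (G.SL + Q.SL * |U|) * |U| * (2 * twoLegBar G Q U 0 n) := by
  have htlb0 : ∀ i, 0 ≤ twoLegBar G Q U 0 i := fun i => twoLegBar_nonneg' hG hQ U 0 i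
  have hqq0 : 0 ≤ 4 / 3 * (G.SL + Q.SL * |U|) * |U| := by
    have hSL : 0 ≤ G.SL := hG.2.2.2.2.2.2.2.2.2.2.2.2.2.2.2.2.2.2.2
    have hSL' : 0 ≤ Q.SL := hQ.2.2.2.2.2.2.1
    positivity
  -- feasibility of a step at level `m` with pre-step bound `2·twoLegBar 0 m`
  have hfeas : ∀ m ≤ nScales β, ∀ j ≤ m,
      ∑ i ∈ Ico (j + 1) (m + 1), twoLegBar G Q U 0 i + 4 / 3 * (G.SL + Q.SL * |U|) * |U| * (2 * twoLegBar G Q U 0 m) + wig j ≤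
        ctCr G * |U| * klScale klE0 j ^ 2 / klE0 := by
    intro m hm j hj
    have h := ct_budget wig hG hQ hwig hS0' hq hj hm
    have htolpos : 0 ≤ ctCr G * |U| * klScale klE0 j ^ 2 / klE0 := by
      have hS : 0 ≤ G.S 0 := hG.2.2.2.2.2.2.2.2.2.2.2.2.2.2.2.2.2.1 0
      have : 0 ≤ ctCr G := by unfold ctCr; positivity
      have he0 : (0 : ℝ) < klE0 := by norm_num [klE0]
      positivity
    linarith
  induction n with
  | zero =>
    -- the zero frame is admissible; one step at level 0
    have hzero : FrameOK R U (nScales β) μ (0 : TrigPolyC4v) := by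
      refine frameOK_of_pieces hR hμ (K := 0) (Kp := fun _ => 0) (N := nScales β) (fun p => by simp [eval_fsub]) ?_ h0 h1 h2
      intro m _ j _ q
      rw [evalM_zero_eq, iteratedFDeriv_fun_zero]
      simp only [Pi.zero_apply, norm_zero]
      exact mul_nonneg (mul_nonneg (hR j) (uPow_nonneg j U)) (zpow_nonneg (by norm_num) _)
    have hpre : ∀ q : Fin 2 → ℝ, |(0 : TrigPolyC4v).eval q + ∑ i ∈ range (0 + 1), (klTwoLegPieceG L M β U μ 0 i).eval q| ≤
        2 * twoLegBar G Q U 0 0 := by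
      intro q
      rw [TrigPolyC4v.eval_zero, zero_add, zero_add, sum_range_one]
      have := abs_eval_piece_le_of_block blk hzero (i := 0) (Nat.zero_le _) (fun j hj => absurd hj (Nat.not_lt_zero j)) q
      linarith [htlb0 0]
    obtain ⟨hK', hren', hS'⟩ := ct_step wig hG hQ hμ hR hcr blk hread hroomA hroomB h0 h1 h2 hzero (Nat.zero_le _)
      (fun j hj => absurd hj (Nat.not_lt_zero j)) (by linarith [htlb0 0]) hpre (hfeas 0 hn)
    exact ⟨_, hK', hren', hS'⟩
  | succ n ih =>
    obtain ⟨K, hK, hren, hS⟩ := ih (Nat.le_of_succ_le hn)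
    -- level-up: pre-step data at level `n + 1`
    have hSn : ∀ q : Fin 2 → ℝ, |K.eval q + ∑ i ∈ range (n + 1), (klTwoLegPieceG L M β U μ K i).eval q| ≤
        4 / 3 * (G.SL + Q.SL * |U|) * |U| * (2 * twoLegBar G Q U 0 n) := by
      intro q
      have h := hS n le_rfl q
      rwa [Finset.Ico_self, sum_empty, zero_add] at h
    obtain ⟨hren', hpre⟩ := ct_levelUp blk hK hn hren hSn
    -- the pre-step bound is at most `2·twoLegBar 0 (n+1)`
    have hpre' : ∀ q : Fin 2 → ℝ, |K.eval q + ∑ i ∈ range (n + 1 + 1), (klTwoLegPieceG L M β U μ K i).eval q| ≤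
        2 * twoLegBar G Q U 0 (n + 1) := by
      intro q
      refine (hpre q).trans ?_
      have h16 : twoLegBar G Q U 0 n = 16 * twoLegBar G Q U 0 (n + 1) := by
        simp only [ct_twoLegBar_zero_eq, pow_succ, mul_inv]
        ring
      rw [h16]
      nlinarith [htlb0 (n + 1)]
    obtain ⟨hK', hren'', hS'⟩ := ct_step wig hG hQ hμ hR hcr blk hread hroomA hroomB h0 h1 h2 hK hn hren' (by linarith [htlb0 (n + 1)]) hpre'
      (hfeas (n + 1) hn)
    exact ⟨_, hK', hren'', hS'⟩

/-- **THE ONE-VOLUME CONSTRUCTION GIVEN THE READING** (child Counterterm's analytic content at one volume): at a volume carrying the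
block (engine slot `E`) and the reading inequality with slack `wig n ≤ |U|16^{-n}/256`, under the numeric side conditions on `U` and the three allowance
sums, there is an ADMISSIBLE frame whose scale-`n` local part is within HALF the quadratic tolerance at every scale `n ≤ nScales β` and
every real angle. -/
theorem ct_oneVolume_of_reading (hG : G.WF) (hQ : Q.WF) (hμ : μ ∈ klWindowC) (hR : ∀ j, 0 ≤ R.Gfr j) (hcr : R.cr = ctCr G)
    (blk : ∀ K : TrigPolyC4v, FrameOK R U (nScales β) μ K → ∀ n : ℕ, n ≤ nScales β →
      (∀ j < n, RenormalisedAtF L M β U μ K R j) →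
        E L M G P Q β U μ K n ∧ TwoLegStepE L M E G P Q R β U μ K n ∧ BetaSplitAtS2 L M G P Q β U μ K n)
    (hread : ∀ K : TrigPolyC4v, FrameOK R U (nScales β) μ K → ∀ n : ℕ, n ≤ nScales β →
      (∀ j < n, RenormalisedAtF L M β U μ K R j) → ∀ B : ℝ,
        (∀ q : Fin 2 → ℝ, |K.eval q + ∑ i ∈ range (n + 1), (klTwoLegPieceG L M β U μ K i).eval q| ≤ B) →
          ∀ θ : ℝ, |klLocalPart L M β U μ K n θ| ≤ B + wig n)
    (hwig : ∀ n ≤ nScales β, wig n ≤ |U| * ((16 : ℝ) ^ n)⁻¹ / 256)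
    (hS0' : Q.S' 0 * |U| ≤ 1 / 10) (hq : 4 / 3 * (G.SL + Q.SL * |U|) * |U| ≤ 1 / 1000)
    (hroomA : ∀ j ≤ 4, 2 * (G.S j + Q.S' j * |U|) ≤ R.Gfr j) (hroomB : ∀ n : ℕ, ∑ i ∈ range (n + 1), msBar G Q U i ≤ 1 / 2)
    (h0 : ∑ m ∈ range (nScales β + 1), R.Gfr 0 * uPow 0 U * (4 : ℝ) ^ (((0 : ℤ) - 2) * m) ≤ 3 / 80)
    (h1 : ∑ m ∈ range (nScales β + 1), R.Gfr 1 * uPow 1 U * (4 : ℝ) ^ (((1 : ℤ) - 2) * m) ≤ 1 / 2000)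
    (h2 : ∑ m ∈ range (nScales β + 1), ∑ j ∈ range 3, R.Gfr j * uPow j U * (4 : ℝ) ^ (((j : ℤ) - 2) * m) ≤ 1 / 100) :
    ∃ K : TrigPolyC4v, FrameOK R U (nScales β) μ K ∧
      ∀ n ≤ nScales β, ∀ θ : ℝ, |klLocalPart L M β U μ K n θ| ≤ ctCr G * |U| * klScale klE0 n ^ 2 / klE0 / 2 := by
  obtain ⟨K, hK, hren, hS⟩ := ct_exists_post wig hG hQ hμ hR hcr blk hread hwig hS0' hq hroomA hroomB h0 h1 h2 (nScales β) le_rfl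
  refine ⟨K, hK, fun n hn θ => ?_⟩
  have h := hread K hK n hn (fun j hj => hren j (le_of_lt (lt_of_lt_of_le hj hn))) _ (hS n hn) θ
  exact h.trans (by have := ct_budget wig hG hQ hwig hS0' hq hn le_rfl; linarith)

end Main

end Summit.HubbardSuperconductivity.HubbardSuperconductivity.Theorems.KLRegimeSplit.CtE

end
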